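import Summits.CriticalPhenomena.PercolationContinuityZ3.Theorems.PercShatteringRaceRaceLemma
import Summits.CriticalPhenomena.PercolationContinuityZ3.Theorems.FreeSusceptibilityPowerSaving.Negative.FreeSusceptibilityPowerSavingBounds
import HarnessLib

/-!
# Crux `PercShatteringRace.FreeSusceptibilityPowerSaving` = S(1/2) (stmt-CriticalPhenomena-5786) — the race lemma INFINITELY OFTEN in the scale (census v2 S⁺7 `RaceLemmaIO`)

Helper file of the line lead c12 (prover-line-stmt-CriticalPhenomena-5786-c12-0),
`--supports stmt-CriticalPhenomena-5786` (registered stub `stub_raceLemmaIO`).  It proves the support the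
crux's STRATEGY-CENSUS v2 (strategist s1, 2026-08-17, `Cruxes/FreeSusceptibilityPowerSaving/STRATEGY-CENSUS.md`
§S⁺7 and R1; typed there as the Prop `CensusS1.RaceLemmaIO`, "provable now") asks for: in the route's race
`S(a) ∧ U(b) ⟹ θ(p_c) = 0` (`Theses.PercShatteringRace.RaceLemma`, landed as `Theorems.raceLemma_proof`) the
free-susceptibility power saving `S(a)` is needed only ALONG SOME SEQUENCE OF SCALES `R_k → ∞`
(`∃ C, ∃ᶠ R, χᶠ_R(p_c) ≤ C R^{3-a}`), not for every `R ≥ 1`.  Hence the crux S(1/2) may be restated by the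
tenure planner in the genuinely weaker i.o.-in-scale form (and in jump form) without touching the logic of the
deciding theorem (census v2 R1); `percolationContinuityZ3_of_io` below is the instance `(a, b) = (1/2, 1/6)`
with the sibling crux `NearLinearTwoClusterDecay` = U(1/6) by name.

Proof.  If `θ := θ(p_c) > 0` then, by U(b) and `theta_sq_le_real_openConnIn_add_real_twoClusters`
(landed with the race lemma), `P(0 ↔ y inside Λ_{R(n)}) ≥ θ²/2` for all `y ∈ Λ_n`, `R(n) = ⌈n^{1+b}⌉`, `n ≥ N`
(`sum_lower_at_aspect`, the finite-scale core of `raceLemma_proof`, verbatim); by MONOTONICITY of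
`χᶠ_R = Σ_{y ∈ Λ_R} P(0 ↔ y inside Λ_R)` in `R` (`Negative.sum_mono_R`) this lower bound propagates from the
sparse scales `R(n)` to ALL large scales: `χᶠ_R ≥ (θ²/2) R^{3/(1+b)}` for `R ≥ R₀` (`sum_lower_all_scales`, with
`n = ⌊R^{1/(1+b)}⌋`, `R(n) ≤ R`, `(2n+1)³ ≥ (n+1)³ ≥ R^{3/(1+b)}`).  An upper bound `χᶠ_R ≤ C R^{3-a}` holding for
infinitely many `R` then contradicts `3 - a < 3/(1+b)`, i.e. `(1+b)(3-a) < 3` (`stub_raceLemmaIO`).  So the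
"eventually" lower bound of the jump world meets the "frequently" upper bound of S — which is why i.o. suffices.
No definitions; tree inputs as in `PercShatteringRaceRaceLemma.lean` plus `Negative.sum_mono_R`.
-/

noncomputable section

namespace Summit.CriticalPhenomena.PercolationContinuityZ3.Theorems

open MeasureTheory Filter Literature.Probability.Percolation Literature.Probability.LatticeModels
open scoped Topology

namespace RaceLemmaIO

/-- **Finite-scale core of the race (jump world).**  If `θ = θ(p_c) > 0` on `ℤ³` and the two-cluster
event of `(Λ_n, Λ_{⌈n^{1+b}⌉})` has probability `→ 0` (U(b)), then for all large `n ≥ 1` the free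
susceptibility of the centre at scale `R(n) = ⌈n^{1+b}⌉` is at least `(2n+1)³ θ²/2`: every `y ∈ Λ_n` has
`P(0 ↔ y inside Λ_{R(n)}) ≥ θ² − P(two clusters) ≥ θ²/2`.  (Verbatim the `hsum` step of
`raceLemma_proof`; Grimmett 1999 §8.5 for the FKG input.) -/
theorem sum_lower_at_aspect {b : ℝ} (hb : 0 < b)
    (hθ : 0 < theta (zdGraph 3) (0 : Site 3) (criticalProbI 3))
    (hU : Tendsto (fun n : ℕ => (bondPercolation (zdGraph 3) (criticalProbI 3)).real
      {ω | ∃ x ∈ box 3 n, ∃ x' ∈ box 3 n,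
        ∃ y ∈ innerBoundary (zdGraph 3) (box 3 ⌈(n : ℝ) ^ (1 + b)⌉₊),
        ∃ y' ∈ innerBoundary (zdGraph 3) (box 3 ⌈(n : ℝ) ^ (1 + b)⌉₊),
          ω ∈ openConnIn (↑(box 3 ⌈(n : ℝ) ^ (1 + b)⌉₊) : Set (Site 3)) x y ∧
          ω ∈ openConnIn (↑(box 3 ⌈(n : ℝ) ^ (1 + b)⌉₊) : Set (Site 3)) x' y' ∧
          ω ∉ openConnIn (↑(box 3 ⌈(n : ℝ) ^ (1 + b)⌉₊) : Set (Site 3)) x x'}) atTop (𝓝 0)) :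
    ∃ N : ℕ, ∀ n : ℕ, N ≤ n → 1 ≤ n →
      (((2 * n + 1) ^ 3 : ℕ) : ℝ) * (theta (zdGraph 3) (0 : Site 3) (criticalProbI 3) ^ 2 / 2) ≤
        ∑ y ∈ box 3 ⌈(n : ℝ) ^ (1 + b)⌉₊, (bondPercolation (zdGraph 3) (criticalProbI 3)).real
          (openConnIn (↑(box 3 ⌈(n : ℝ) ^ (1 + b)⌉₊) : Set (Site 3)) 0 y) := by
  set μ := bondPercolation (zdGraph 3) (criticalProbI 3) with hμ
  set θ := theta (zdGraph 3) (0 : Site 3) (criticalProbI 3) with hθdef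
  have hθ2 : 0 < θ ^ 2 / 2 := by positivity
  -- `U(b)`: eventually the two-cluster event has probability `< θ² / 2`
  obtain ⟨N, hN⟩ := (hU.eventually (gt_mem_nhds hθ2)).exists_forall_of_atTop
  refine ⟨N, fun n hNn hn => ?_⟩
  set R : ℕ := ⌈(n : ℝ) ^ (1 + b)⌉₊ with hR
  have hn1 : (1 : ℝ) ≤ n := by exact_mod_cast hn
  have hnR : n ≤ R := by
    have h1 : (n : ℝ) ≤ (n : ℝ) ^ (1 + b) := Real.self_le_rpow_of_one_le hn1 (by linarith)
    have h2 : (n : ℝ) ≤ (R : ℝ) := h1.trans (Nat.le_ceil _)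
    exact_mod_cast h2
  -- pointwise lower bound on `Λ_n`
  have hlow : ∀ y ∈ box 3 n, θ ^ 2 / 2 ≤ μ.real (openConnIn (↑(box 3 R) : Set (Site 3)) 0 y) := by
    intro y hy
    have h1 := theta_sq_le_real_openConnIn_add_real_twoClusters (criticalProbI 3) hnR
      (zero_mem_box 3 n) hy
    have h2 := hN n hNn
    rw [← hμ, ← hθdef] at h1
    linarith
  calc (((2 * n + 1) ^ 3 : ℕ) : ℝ) * (θ ^ 2 / 2) = ∑ _y ∈ box 3 n, θ ^ 2 / 2 := by
        rw [Finset.sum_const, card_box, nsmul_eq_mul]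
    _ ≤ ∑ y ∈ box 3 n, μ.real (openConnIn (↑(box 3 R) : Set (Site 3)) 0 y) :=
        Finset.sum_le_sum hlow
    _ ≤ ∑ y ∈ box 3 R, μ.real (openConnIn (↑(box 3 R) : Set (Site 3)) 0 y) :=
        Finset.sum_le_sum_of_subset_of_nonneg (box_mono 3 hnR) fun _ _ _ => measureReal_nonneg

/-- **The jump-world lower bound at EVERY large scale.**  Under the hypotheses of
`sum_lower_at_aspect`, `χᶠ_R(p_c) = Σ_{y ∈ Λ_R} P(0 ↔ y inside Λ_R) ≥ (θ²/2) R^{3/(1+b)}` for all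
`R ≥ R₀`: take `n = ⌊R^{1/(1+b)}⌋`, so that `⌈n^{1+b}⌉ ≤ R` and `(2n+1)³ ≥ (n+1)³ ≥ R^{3/(1+b)}`, and use
the monotonicity of `χᶠ_R` in `R` (`Negative.sum_mono_R`).  This is the step that lets an upper bound
at SPARSE scales race against U. -/
theorem sum_lower_all_scales {b : ℝ} (hb : 0 < b)
    (hθ : 0 < theta (zdGraph 3) (0 : Site 3) (criticalProbI 3))
    (hU : Tendsto (fun n : ℕ => (bondPercolation (zdGraph 3) (criticalProbI 3)).real
      {ω | ∃ x ∈ box 3 n, ∃ x' ∈ box 3 n,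
        ∃ y ∈ innerBoundary (zdGraph 3) (box 3 ⌈(n : ℝ) ^ (1 + b)⌉₊),
        ∃ y' ∈ innerBoundary (zdGraph 3) (box 3 ⌈(n : ℝ) ^ (1 + b)⌉₊),
          ω ∈ openConnIn (↑(box 3 ⌈(n : ℝ) ^ (1 + b)⌉₊) : Set (Site 3)) x y ∧
          ω ∈ openConnIn (↑(box 3 ⌈(n : ℝ) ^ (1 + b)⌉₊) : Set (Site 3)) x' y' ∧
          ω ∉ openConnIn (↑(box 3 ⌈(n : ℝ) ^ (1 + b)⌉₊) : Set (Site 3)) x x'}) atTop (𝓝 0)) :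
    ∃ R₀ : ℕ, ∀ R : ℕ, R₀ ≤ R →
      theta (zdGraph 3) (0 : Site 3) (criticalProbI 3) ^ 2 / 2 * (R : ℝ) ^ (3 / (1 + b)) ≤
        ∑ y ∈ box 3 R, (bondPercolation (zdGraph 3) (criticalProbI 3)).real
          (openConnIn (↑(box 3 R) : Set (Site 3)) 0 y) := by
  obtain ⟨N, hN⟩ := sum_lower_at_aspect hb hθ hU
  set θ := theta (zdGraph 3) (0 : Site 3) (criticalProbI 3) with hθdef
  have hb1 : 0 < 1 + b := by linarith
  -- threshold: `R ≥ (max N 1)^{1+b}` guarantees `n := ⌊R^{1/(1+b)}⌋ ≥ max N 1`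
  refine ⟨⌈((max N 1 : ℕ) : ℝ) ^ (1 + b)⌉₊, fun R hR => ?_⟩
  have hM1 : (1 : ℝ) ≤ ((max N 1 : ℕ) : ℝ) := by exact_mod_cast le_max_right N 1
  have hM0 : (0 : ℝ) ≤ ((max N 1 : ℕ) : ℝ) := zero_le_one.trans hM1
  have hRreal : ((max N 1 : ℕ) : ℝ) ^ (1 + b) ≤ (R : ℝ) :=
    (Nat.le_ceil _).trans (by exact_mod_cast hR)
  have hR1 : (1 : ℝ) ≤ (R : ℝ) := (Real.one_le_rpow hM1 hb1.le).trans hRreal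
  have hR0 : (0 : ℝ) ≤ (R : ℝ) := zero_le_one.trans hR1
  -- the scale `n`
  set x : ℝ := (R : ℝ) ^ (1 / (1 + b)) with hx
  have hx0 : 0 ≤ x := Real.rpow_nonneg hR0 _
  set n : ℕ := ⌊x⌋₊ with hn
  have hxpow : x ^ (1 + b) = (R : ℝ) := by
    rw [hx, ← Real.rpow_mul hR0, one_div, inv_mul_cancel₀ hb1.ne', Real.rpow_one]
  -- `max N 1 ≤ n`
  have hMx : ((max N 1 : ℕ) : ℝ) ≤ x := by
    have h1 : (((max N 1 : ℕ) : ℝ) ^ (1 + b)) ^ (1 / (1 + b)) ≤ (R : ℝ) ^ (1 / (1 + b)) :=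
      Real.rpow_le_rpow (Real.rpow_nonneg hM0 _) hRreal (by positivity)
    rw [← Real.rpow_mul hM0, mul_one_div_cancel hb1.ne', Real.rpow_one] at h1
    rw [hx]
    exact h1
  have hMn : max N 1 ≤ n := Nat.le_floor hMx
  have hNn : N ≤ n := (le_max_left N 1).trans hMn
  have hn1 : 1 ≤ n := (le_max_right N 1).trans hMn
  -- `⌈n^{1+b}⌉ ≤ R`
  have hnx : (n : ℝ) ≤ x := Nat.floor_le hx0
  have hn0 : (0 : ℝ) ≤ (n : ℝ) := Nat.cast_nonneg _
  have hceil : ⌈(n : ℝ) ^ (1 + b)⌉₊ ≤ R := by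
    refine Nat.ceil_le.2 ?_
    calc (n : ℝ) ^ (1 + b) ≤ x ^ (1 + b) := Real.rpow_le_rpow hn0 hnx hb1.le
      _ = (R : ℝ) := hxpow
  -- `R^{3/(1+b)} ≤ (2n+1)³`
  have hcube : (R : ℝ) ^ (3 / (1 + b)) ≤ (((2 * n + 1) ^ 3 : ℕ) : ℝ) := by
    have hx1 : x < (n : ℝ) + 1 := Nat.lt_floor_add_one x
    have h3 : (R : ℝ) ^ (3 / (1 + b)) = x ^ (3 : ℕ) := by
      rw [hx, ← Real.rpow_natCast, ← Real.rpow_mul hR0]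
      norm_num [div_eq_inv_mul]
    rw [h3]
    calc x ^ (3 : ℕ) ≤ ((n : ℝ) + 1) ^ (3 : ℕ) := pow_le_pow_left₀ hx0 hx1.le 3
      _ ≤ (((2 * n + 1) ^ 3 : ℕ) : ℝ) := by
          push_cast
          exact pow_le_pow_left₀ (by positivity) (by linarith) 3
  have hθ2 : 0 ≤ θ ^ 2 / 2 := by positivity
  calc θ ^ 2 / 2 * (R : ℝ) ^ (3 / (1 + b)) ≤ θ ^ 2 / 2 * (((2 * n + 1) ^ 3 : ℕ) : ℝ) :=
        mul_le_mul_of_nonneg_left hcube hθ2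
    _ = (((2 * n + 1) ^ 3 : ℕ) : ℝ) * (θ ^ 2 / 2) := mul_comm _ _
    _ ≤ ∑ y ∈ box 3 ⌈(n : ℝ) ^ (1 + b)⌉₊, (bondPercolation (zdGraph 3) (criticalProbI 3)).real
          (openConnIn (↑(box 3 ⌈(n : ℝ) ^ (1 + b)⌉₊) : Set (Site 3)) 0 y) := hN n hNn hn1
    _ ≤ _ := FreeSusceptibilityPowerSaving.Negative.sum_mono_R (criticalProbI 3) hceil

end RaceLemmaIO

/-- **The race lemma, infinitely often in the scale** (registered stub `stub_raceLemmaIO` of the crux item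
stmt-CriticalPhenomena-5786; census v2 S⁺7 `RaceLemmaIO`, verbatim with the measure written out): for real
`a, b` with `0 < b` and `(1 + b)(3 − a) < 3`, an upper bound `Σ_{y ∈ Λ_R} P_{p_c}(0 ↔ y inside Λ_R) ≤ C R^{3−a}`
holding for INFINITELY MANY `R` (`∃ᶠ R in atTop`) and the two-cluster decay U(b) at aspect `⌈n^{1+b}⌉`
already force `θ(p_c) = 0` on `ℤ³`.  Proof: otherwise `θ > 0` and `RaceLemmaIO.sum_lower_all_scales` gives
`Σ ≥ (θ²/2) R^{3/(1+b)}` for ALL large `R`, against `C R^{3−a}` at infinitely many `R`, with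
`3 − a < 3/(1+b)`. -/
theorem stub_raceLemmaIO : ∀ a b : ℝ, 0 < b → (1 + b) * (3 - a) < 3 → (∃ C : ℝ, ∃ᶠ R : ℕ in Filter.atTop, ∑ y ∈ box 3 R, (bondPercolation (zdGraph 3) (criticalProbI 3)).real (openConnIn (↑(box 3 R) : Set (Site 3)) 0 y) ≤ C * (R : ℝ) ^ (3 - a)) → Filter.Tendsto (fun n : ℕ => (bondPercolation (zdGraph 3) (criticalProbI 3)).real {ω | ∃ x ∈ box 3 n, ∃ x' ∈ box 3 n, ∃ y ∈ innerBoundary (zdGraph 3) (box 3 ⌈(n : ℝ) ^ (1 + b)⌉₊), ∃ y' ∈ innerBoundary (zdGraph 3) (box 3 ⌈(n : ℝ) ^ (1 + b)⌉₊), ω ∈ openConnIn (↑(box 3 ⌈(n : ℝ) ^ (1 + b)⌉₊) : Set (Site 3)) x y ∧ ω ∈ openConnIn (↑(box 3 ⌈(n : ℝ) ^ (1 + b)⌉₊) : Set (Site 3)) x' y' ∧ ω ∉ openConnIn (↑(box 3 ⌈(n : ℝ) ^ (1 + b)⌉₊) : Set (Site 3)) x x'}) Filter.atTop (nhds 0)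 → _root_.PercolationContinuityZ3 := by
  intro a b hb hab hS hU
  by_contra hne
  have hθ : 0 < theta (zdGraph 3) (0 : Site 3) (criticalProbI 3) :=
    lt_of_le_of_ne measureReal_nonneg (Ne.symm hne)
  set θ := theta (zdGraph 3) (0 : Site 3) (criticalProbI 3) with hθdef
  obtain ⟨R₀, hR₀⟩ := RaceLemmaIO.sum_lower_all_scales hb hθ hU
  obtain ⟨C, hC⟩ := hS
  have hb1 : 0 < 1 + b := by linarith
  -- the exponent gap `e := 3/(1+b) - (3 - a) > 0`
  have hgap : 0 < 3 / (1 + b) - (3 - a) := by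
    have : 3 - a < 3 / (1 + b) := by
      rw [lt_div_iff₀ hb1]; linarith
    linarith
  have hθ2 : 0 < θ ^ 2 / 2 := by positivity
  have ht : Tendsto (fun R : ℕ => θ ^ 2 / 2 * ((R : ℝ) ^ (3 / (1 + b) - (3 - a)))) atTop atTop :=
    Tendsto.const_mul_atTop hθ2 ((tendsto_rpow_atTop hgap).comp tendsto_natCast_atTop_atTop)
  -- a good scale `R` beyond every threshold
  obtain ⟨R, ⟨hgt, hR1, hRR₀⟩, hSR⟩ :=
    (((ht.eventually_gt_atTop C).and ((eventually_ge_atTop 1).and (eventually_ge_atTop R₀))).and_frequently hC).exists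
  have hRpos : (0 : ℝ) < R := by exact_mod_cast hR1
  have h1 := (hR₀ R hRR₀).trans hSR
  have hsplit : (R : ℝ) ^ (3 / (1 + b)) = (R : ℝ) ^ (3 / (1 + b) - (3 - a)) * (R : ℝ) ^ (3 - a) := by
    rw [← Real.rpow_add hRpos]; ring_nf
  rw [hsplit, ← mul_assoc] at h1
  have h2 := le_of_mul_le_mul_right h1 (Real.rpow_pos_of_pos hRpos _)
  linarith

/-- **Instance for the route as filed**: S(1/2) INFINITELY OFTEN in the scale, together with the sibling
crux `NearLinearTwoClusterDecay` = U(1/6) by name, gives the sub-problem statement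
`PercolationContinuityZ3` (`(1 + 1/6)(3 − 1/2) = 35/12 < 3`).  This is what a jump-form or i.o.-form restatement
of stmt-CriticalPhenomena-5786 (census v2 R1) would feed the deciding theorem. -/
theorem percolationContinuityZ3_of_io
    (hS : ∃ C : ℝ, ∃ᶠ R : ℕ in atTop, ∑ y ∈ box 3 R, (bondPercolation (zdGraph 3) (criticalProbI 3)).real
      (openConnIn (↑(box 3 R) : Set (Site 3)) 0 y) ≤ C * (R : ℝ) ^ ((5 : ℝ) / 2))
    (hU : Summit.CriticalPhenomena.PercolationContinuityZ3.Theses.PercShatteringRace.NearLinearTwoClusterDecay) :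
    _root_.PercolationContinuityZ3 := by
  have h := stub_raceLemmaIO (1 / 2) (1 / 6) (by norm_num) (by norm_num)
  have e1 : (3 : ℝ) - 1 / 2 = 5 / 2 := by norm_num
  have e2 : (1 : ℝ) + 1 / 6 = 7 / 6 := by norm_num
  rw [e1, e2] at h
  exact h hS hU

/-- The crux as filed trivially gives its i.o. form (so `percolationContinuityZ3_of_io` recovers the
route's `closes` with `raceLemma_proof` replaced by `stub_raceLemmaIO`). -/
theorem io_of_freeSusceptibilityPowerSaving
    (h : Summit.CriticalPhenomena.PercolationContinuityZ3.Theses.PercShatteringRace.FreeSusceptibilityPowerSaving) :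
    ∃ C : ℝ, ∃ᶠ R : ℕ in atTop, ∑ y ∈ box 3 R, (bondPercolation (zdGraph 3) (criticalProbI 3)).real
      (openConnIn (↑(box 3 R) : Set (Site 3)) 0 y) ≤ C * (R : ℝ) ^ ((5 : ℝ) / 2) := by
  obtain ⟨C, hC⟩ := h
  exact ⟨C, ((eventually_ge_atTop 1).mono fun R hR => hC R hR).frequently⟩

end Summit.CriticalPhenomena.PercolationContinuityZ3.Theorems

end
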